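import Mathlib
import Summits.KontsevichZagierPeriods.KontsevichZagierPeriods.Theorems.InverseLandauTateLiftingLowDimAlgSector
import Summits.KontsevichZagierPeriods.KontsevichZagierPeriods.Theorems.InverseLandauTateLiftingSqrtReduce
import Summits.KontsevichZagierPeriods.KontsevichZagierPeriods.Theorems.InverseLandauTateLiftingSqrtAffineReduce

/-!
# `TateLifting` (stmt-KontsevichZagierPeriods-9129), line `Sketch` — the affine square-root extension of the
# low-dimensional algebraic sector (all parabolas `y² = ax + b`)

Sequel to `Theorems/InverseLandauTateLiftingSqrtSector.lean` (lead c6): there the generators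
`[σ ⊆ (0,∞), P(x,√x)/Q(x,√x)]` were adjoined to the dimension-≤-1 algebraic sector
(`kzKernelConjecture_lowDimAlg`, Baker inside the calculus); here moreover the generators
`[σ, P(x,√(ax+b))/Q(x,√(ax+b))]` for real-algebraic `a > 0`, `b` (`ax + b > 0` on `σ`; `P, Q ∈ K[X,Y]`,
`K = algebraicClosure ℚ ℝ`): one affine move `u = ax + b` (rule (2)) followed by the square substitution
(`tateLifting_sqrtAffineReduce`, stub 37). Results: `sqrtAffineLowDimKernel` — the kernel form of
Conjecture 1 on the subgroup generated by point representations, algebraic-coefficient rational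
representations of dimension one, `√x`-representations and `√(ax+b)`-representations (all integrands in the
function field of a PARABOLA over `ℚ̄ ∩ ℝ`); `TateLifting_sqrtAffineSector` — the crux on it;
`kzPeriodConjecture_sqrtAffine` — the pair form.

References: M. Kontsevich, D. Zagier, *Periods* (2001), §1.2 (Conjecture 1, rule (2)); A. Baker,
*Transcendental Number Theory* (1975), Thm 2.1 (through `kzKernelConjecture_lowDimAlg`).
-/

noncomputable section

open MeasureTheory Set
open Literature.NumberTheory.Transcendental

namespace Summit.KontsevichZagierPeriods.InverseLandau

namespace SqrtAffineSector

/-- **Reduction of the generators** to the low-dimensional algebraic sector: rational generators are their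
own representatives, `√x`-generators reduce by `tateLifting_sqrtReduce` (stub 35), `√(ax+b)`-generators by
`tateLifting_sqrtAffineReduce` (stub 37). [cite: KontsevichZagier2001, §1.2 rule (2)] -/
theorem reduce :
    ∀ d ∈ ({d : KZ.FormalRep | (∃ r : KZ.IntegralRep 0, d = KZ.of r) ∨
            ∃ (r : KZ.IntegralRep 1) (p q : Polynomial ℝ), (∀ i, IsAlgebraic ℚ (p.coeff i)) ∧
              (∀ i, IsAlgebraic ℚ (q.coeff i)) ∧ (∀ x ∈ r.domain, q.eval (x 0) ≠ 0) ∧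
              Set.EqOn r.integrand (fun x => p.eval (x 0) / q.eval (x 0)) r.domain ∧ d = KZ.of r} ∪
          {d : KZ.FormalRep | ∃ (P Q : MvPolynomial (Fin 2) (algebraicClosure ℚ ℝ))
              (r : KZ.IntegralRep 1),
            (∀ x ∈ r.domain, 0 < x 0) ∧
            (∀ x ∈ r.domain, MvPolynomial.aeval ![x 0, Real.sqrt (x 0)] Q ≠ 0) ∧
            Set.EqOn r.integrand (fun x => MvPolynomial.aeval ![x 0, Real.sqrt (x 0)] P /
              MvPolynomial.aeval ![x 0, Real.sqrt (x 0)] Q) r.domain ∧ d = KZ.of r} ∪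
          {d : KZ.FormalRep | ∃ (a b : algebraicClosure ℚ ℝ)
              (P Q : MvPolynomial (Fin 2) (algebraicClosure ℚ ℝ)) (r : KZ.IntegralRep 1),
            0 < (a : ℝ) ∧ (∀ x ∈ r.domain, 0 < (a : ℝ) * x 0 + b) ∧
            (∀ x ∈ r.domain, MvPolynomial.aeval ![x 0, Real.sqrt ((a : ℝ) * x 0 + b)] Q ≠ 0) ∧
            Set.EqOn r.integrand (fun x => MvPolynomial.aeval ![x 0, Real.sqrt ((a : ℝ) * x 0 + b)] P /
              MvPolynomial.aeval ![x 0, Real.sqrt ((a : ℝ) * x 0 + b)] Q) r.domain ∧ d = KZ.of r}),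
      ∃ ℓ ∈ {d : KZ.FormalRep | (∃ r : KZ.IntegralRep 0, d = KZ.of r) ∨
            ∃ (r : KZ.IntegralRep 1) (p q : Polynomial ℝ), (∀ i, IsAlgebraic ℚ (p.coeff i)) ∧
              (∀ i, IsAlgebraic ℚ (q.coeff i)) ∧ (∀ x ∈ r.domain, q.eval (x 0) ≠ 0) ∧
              Set.EqOn r.integrand (fun x => p.eval (x 0) / q.eval (x 0)) r.domain ∧ d = KZ.of r},
        d - ℓ ∈ KZ.relations := by
  rintro d ((hd | ⟨P, Q, r, hpos, hQ, hint, rfl⟩) | ⟨a, b, P, Q, r, ha, hpos, hQ, hint, rfl⟩)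
  · exact ⟨d, hd, by rw [sub_self]; exact KZ.relations.zero_mem⟩
  · obtain ⟨ρ, p, q, hp, hq, hq0, hpq, hrel⟩ := tateLifting_sqrtReduce P Q r hpos hQ hint
    exact ⟨KZ.of ρ, Or.inr ⟨ρ, p, q, hp, hq, hq0, hpq, rfl⟩, hrel⟩
  · obtain ⟨ρ, p, q, hp, hq, hq0, hpq, hrel⟩ := tateLifting_sqrtAffineReduce a b P Q r ha hpos hQ hint
    exact ⟨KZ.of ρ, Or.inr ⟨ρ, p, q, hp, hq, hq0, hpq, rfl⟩, hrel⟩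

end SqrtAffineSector

/-- **THE AFFINE SQUARE-ROOT EXTENSION OF THE LOW-DIMENSIONAL ALGEBRAIC SECTOR (kernel form).** Every
vanishing `ℤ`-combination of: representations over `ℝ⁰`; dimension-one representations with
algebraic-coefficient rational integrand; `√x`-representations `[σ ⊆ (0,∞), P(x,√x)/Q(x,√x)]`; and
`√(ax+b)`-representations `[σ, P(x,√(ax+b))/Q(x,√(ax+b))]` (`a > 0`, `b` real algebraic, `ax+b > 0` on `σ`)
— is a relation of the Kontsevich–Zagier calculus (`SqrtAffineSector.reduce` + soundness +
`kzKernelConjecture_lowDimAlg`). [cite: KontsevichZagier2001, §1.2] -/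
theorem sqrtAffineLowDimKernel :
    ∀ c ∈ AddSubgroup.closure
        ({d : KZ.FormalRep | (∃ r : KZ.IntegralRep 0, d = KZ.of r) ∨
            ∃ (r : KZ.IntegralRep 1) (p q : Polynomial ℝ), (∀ i, IsAlgebraic ℚ (p.coeff i)) ∧
              (∀ i, IsAlgebraic ℚ (q.coeff i)) ∧ (∀ x ∈ r.domain, q.eval (x 0) ≠ 0) ∧
              Set.EqOn r.integrand (fun x => p.eval (x 0) / q.eval (x 0)) r.domain ∧ d = KZ.of r} ∪
          {d : KZ.FormalRep | ∃ (P Q : MvPolynomial (Fin 2) (algebraicClosure ℚ ℝ))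
              (r : KZ.IntegralRep 1),
            (∀ x ∈ r.domain, 0 < x 0) ∧
            (∀ x ∈ r.domain, MvPolynomial.aeval ![x 0, Real.sqrt (x 0)] Q ≠ 0) ∧
            Set.EqOn r.integrand (fun x => MvPolynomial.aeval ![x 0, Real.sqrt (x 0)] P /
              MvPolynomial.aeval ![x 0, Real.sqrt (x 0)] Q) r.domain ∧ d = KZ.of r} ∪
          {d : KZ.FormalRep | ∃ (a b : algebraicClosure ℚ ℝ)
              (P Q : MvPolynomial (Fin 2) (algebraicClosure ℚ ℝ)) (r : KZ.IntegralRep 1),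
            0 < (a : ℝ) ∧ (∀ x ∈ r.domain, 0 < (a : ℝ) * x 0 + b) ∧
            (∀ x ∈ r.domain, MvPolynomial.aeval ![x 0, Real.sqrt ((a : ℝ) * x 0 + b)] Q ≠ 0) ∧
            Set.EqOn r.integrand (fun x => MvPolynomial.aeval ![x 0, Real.sqrt ((a : ℝ) * x 0 + b)] P /
              MvPolynomial.aeval ![x 0, Real.sqrt ((a : ℝ) * x 0 + b)] Q) r.domain ∧ d = KZ.of r}),
      KZ.eval c = 0 → c ∈ KZ.relations := by
  intro c hc hev
  classical
  rw [← Submodule.span_int_eq_addSubgroupClosure, Submodule.mem_toAddSubgroup,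
    Submodule.mem_span_set'] at hc
  obtain ⟨k, f, g, rfl⟩ := hc
  choose ℓ hℓ hrel using fun i => SqrtAffineSector.reduce (g i) (g i).2
  have hdiff : ∑ i, f i • ((g i : KZ.FormalRep)) - ∑ i, f i • ℓ i ∈ KZ.relations := by
    rw [← Finset.sum_sub_distrib]
    refine sum_mem fun i _ => ?_
    rw [← smul_sub]
    exact KZ.relations.zsmul_mem (hrel i) _
  have hmem : ∑ i, f i • ℓ i ∈ AddSubgroup.closure
      {d : KZ.FormalRep | (∃ r : KZ.IntegralRep 0, d = KZ.of r) ∨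
            ∃ (r : KZ.IntegralRep 1) (p q : Polynomial ℝ), (∀ i, IsAlgebraic ℚ (p.coeff i)) ∧
              (∀ i, IsAlgebraic ℚ (q.coeff i)) ∧ (∀ x ∈ r.domain, q.eval (x 0) ≠ 0) ∧
              Set.EqOn r.integrand (fun x => p.eval (x 0) / q.eval (x 0)) r.domain ∧ d = KZ.of r} :=
    sum_mem fun i _ => AddSubgroup.zsmul_mem _ (AddSubgroup.subset_closure (hℓ i)) _
  have hev' : KZ.eval (∑ i, f i • ℓ i) = 0 := by
    have h0 := KZ.relations_le_ker_eval_holds hdiff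
    rw [AddMonoidHom.mem_ker, map_sub, hev, zero_sub, neg_eq_zero] at h0
    exact h0
  have hker := kzKernelConjecture_lowDimAlg _ hmem hev'
  have h := KZ.relations.add_mem hdiff hker
  rwa [sub_add_cancel] at h

/-- **The crux on the affine square-root sector**: every such vanishing combination lies in
`KZ.relations ⊔ closure T` for the Tate set `T` of `TateLifting` (indeed in `KZ.relations`).
[cite: KontsevichZagier2001, §1.2] -/
theorem TateLifting_sqrtAffineSector :
    ∀ c ∈ AddSubgroup.closure
        ({d : KZ.FormalRep | (∃ r : KZ.IntegralRep 0, d = KZ.of r) ∨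
            ∃ (r : KZ.IntegralRep 1) (p q : Polynomial ℝ), (∀ i, IsAlgebraic ℚ (p.coeff i)) ∧
              (∀ i, IsAlgebraic ℚ (q.coeff i)) ∧ (∀ x ∈ r.domain, q.eval (x 0) ≠ 0) ∧
              Set.EqOn r.integrand (fun x => p.eval (x 0) / q.eval (x 0)) r.domain ∧ d = KZ.of r} ∪
          {d : KZ.FormalRep | ∃ (P Q : MvPolynomial (Fin 2) (algebraicClosure ℚ ℝ))
              (r : KZ.IntegralRep 1),
            (∀ x ∈ r.domain, 0 < x 0) ∧
            (∀ x ∈ r.domain, MvPolynomial.aeval ![x 0, Real.sqrt (x 0)] Q ≠ 0) ∧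
            Set.EqOn r.integrand (fun x => MvPolynomial.aeval ![x 0, Real.sqrt (x 0)] P /
              MvPolynomial.aeval ![x 0, Real.sqrt (x 0)] Q) r.domain ∧ d = KZ.of r} ∪
          {d : KZ.FormalRep | ∃ (a b : algebraicClosure ℚ ℝ)
              (P Q : MvPolynomial (Fin 2) (algebraicClosure ℚ ℝ)) (r : KZ.IntegralRep 1),
            0 < (a : ℝ) ∧ (∀ x ∈ r.domain, 0 < (a : ℝ) * x 0 + b) ∧
            (∀ x ∈ r.domain, MvPolynomial.aeval ![x 0, Real.sqrt ((a : ℝ) * x 0 + b)] Q ≠ 0) ∧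
            Set.EqOn r.integrand (fun x => MvPolynomial.aeval ![x 0, Real.sqrt ((a : ℝ) * x 0 + b)] P /
              MvPolynomial.aeval ![x 0, Real.sqrt ((a : ℝ) * x 0 + b)] Q) r.domain ∧ d = KZ.of r}),
      KZ.eval c = 0 → c ∈ KZ.relations ⊔ AddSubgroup.closure {d : KZ.FormalRep |
        ∃ (n : ℕ) (P Q : MvPolynomial (Fin (n + 1)) ℚ) (ε ϖ₀ : ℝ) (r : KZ.IntegralRep n), 0 < ε ∧
        (∃ c₀ : ℚ, c₀ ≠ 0 ∧ ∀ z : Fin n → ℝ,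
          MvPolynomial.aeval (Fin.snoc z (0 : ℝ) : Fin (n + 1) → ℝ) Q = (c₀ : ℝ)) ∧
        (∀ (z : Fin n → ℝ) (ϖ : ℝ), (∀ i, z i ∈ Set.Icc (0 : ℝ) 1) → ϖ ∈ Set.Ioo 0 ε →
          MvPolynomial.aeval (Fin.snoc z ϖ : Fin (n + 1) → ℝ) Q ≠ 0) ∧
        (∀ ϖ ∈ Set.Ioo (0 : ℝ) ε, ∫ z in Set.pi Set.univ (fun _ : Fin n => Set.Ioo (0 : ℝ) 1),
          MvPolynomial.aeval (Fin.snoc z ϖ : Fin (n + 1) → ℝ) P /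
            MvPolynomial.aeval (Fin.snoc z ϖ : Fin (n + 1) → ℝ) Q = 0) ∧
        IsAlgebraic ℚ ϖ₀ ∧ ϖ₀ ∈ Set.Ioo 0 ε ∧
        r.domain = Set.pi Set.univ (fun _ : Fin n => Set.Ioo (0 : ℝ) 1) ∧
        Set.EqOn r.integrand (fun z => MvPolynomial.aeval (Fin.snoc z ϖ₀ : Fin (n + 1) → ℝ) P /
          MvPolynomial.aeval (Fin.snoc z ϖ₀ : Fin (n + 1) → ℝ) Q) r.domain ∧
        d = KZ.of r} :=
  fun c hc h0 => AddSubgroup.mem_sup_left (sqrtAffineLowDimKernel c hc h0)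

/-- **Conjecture 1 for pairs of `√(ax+b)`-representations against rational ones**: a
`√(ax+b)`-representation (`a > 0`) and an algebraic-coefficient rational representation of dimension one
with the same value are KZ-equivalent. [cite: KontsevichZagier2001, §1.2] -/
theorem kzPeriodConjecture_sqrtAffine (a b : algebraicClosure ℚ ℝ)
    (P Q : MvPolynomial (Fin 2) (algebraicClosure ℚ ℝ)) (r r' : KZ.IntegralRep 1) (ha : 0 < (a : ℝ))
    (hpos : ∀ x ∈ r.domain, 0 < (a : ℝ) * x 0 + b)
    (hQ : ∀ x ∈ r.domain, MvPolynomial.aeval ![x 0, Real.sqrt ((a : ℝ) * x 0 + b)] Q ≠ 0)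
    (hint : Set.EqOn r.integrand (fun x => MvPolynomial.aeval ![x 0, Real.sqrt ((a : ℝ) * x 0 + b)] P /
      MvPolynomial.aeval ![x 0, Real.sqrt ((a : ℝ) * x 0 + b)] Q) r.domain)
    (p q : Polynomial ℝ) (hp : ∀ i, IsAlgebraic ℚ (p.coeff i)) (hq : ∀ i, IsAlgebraic ℚ (q.coeff i))
    (hq0 : ∀ x ∈ r'.domain, q.eval (x 0) ≠ 0)
    (hpq : Set.EqOn r'.integrand (fun x => p.eval (x 0) / q.eval (x 0)) r'.domain)
    (hv : r.value = r'.value) : KZ.Equivalent r r' :=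
  sqrtAffineLowDimKernel _
    (sub_mem (AddSubgroup.subset_closure (Or.inr ⟨a, b, P, Q, r, ha, hpos, hQ, hint, rfl⟩))
      (AddSubgroup.subset_closure (Or.inl (Or.inl (Or.inr ⟨r', p, q, hp, hq, hq0, hpq, rfl⟩)))))
    (by rw [map_sub, KZ.eval_of, KZ.eval_of, hv, sub_self])

end Summit.KontsevichZagierPeriods.InverseLandau

end
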